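import Literature.MathematicalPhysics.QuantumFieldTheory.Balaban1983to89.B7Prop9Flat

/-!
# B7 Proposition 10 at the flat background: the induction (201)–(206) for the averaged gauge transformations
`ũ′ʲ` (`B7Prop10Flat`)

Source: T. Bałaban, *Averaging operations for lattice gauge theories*, Commun. Math. Phys. **98** (1985) 17–51
(`Balaban1985Averaging`, "B7"), Sect. F, pp. 45 and 49–50 (renders `1985-cmp98-averaging-p029`, `p033`, `p034-x2.png`, READ AS
IMAGES by the typing seat; journal page = render page + 16).

PRINT (verbatim, pp. 45, 49–50; re-read against the renders for v1.0.1 — v1 carried a PARAPHRASE of this passage taken from the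
lineage transcript, see VERSION below). p. 45: "We will need to consider regular configurations `u′` in the sense that the following
conditions are satisfied: `|u′(x) − 1| < α₄, x ∈ Ω`, (176) `|u′⁻¹(b₋)R_{0,b}u′(b₊) − 1| < α₄η, b ⊂ Ω`. (177) We would like to
know that if `u′` is such a configuration and `u₁` belongs to a class `Λ_k(α₃)`, then the product `u′u₁` belongs to some class
`Λ_k(O(1)(α₃ + α₄))` also. … We will consider the averages `ũ′ʲ = \overline{R₀u′u₁}ʲ(\overline{R₀u₁}ʲ)⁻¹`. (178) As in the case of
averages `Ũ′ʲ`, it can be easily seen that they may be defined inductively as `ũ′¹ = ũ′ = \overline{R₀u′u₁}(\overline{R₀u₁})⁻¹,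
ũ′^{j+1} = \overline{R̄₀ʲũ′ʲ\overline{R₀u₁}ʲ}(\overline{R̄₀ʲ\overline{R₀u₁}ʲ})⁻¹`. (179)"  p. 46: "We will prove that the configuration `ũ′ʲ`
for `j ≦ k` satisfy the regularity conditions (176), (177) on proper scales and with different constants."  p. 49 (after
Proposition 9 and "In these bounds we have assumed that `α′₄ = O(α₄)`, which will always be true here and in forthcoming papers."):
"Let us apply this result to configurations `U₀, u′, u₁` many times. We assume that `U₀` satisfies (52), `u` satisfies (176),
(177), and `u₁` satisfies (166), (167). When we apply it the first time, we get bounds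
`|ũ′⁻¹(c₋)R̄_{0,c}ũ′(c₊) − 1| < α₄Lη + C′₄(α₀α₄ + α₃α₄ + α₄²)(Lη)²`, (201) `|ũ′(y) − 1| < α₄ + C′₅α₄Lη`. (202) Let us denote
`β = α₀α₄ + α₃α₄ + α₄²`, `C₅ = 1 + 4C′₅`, `C₄ = 8C′₄C₅`. We will prove by induction that
`|(ũ′ʲ)⁻¹(c₋)R̄ʲ_{0,c}ũ′ʲ(c₊) − 1| < α₄Lʲη + C₄β(Lʲη)², c ⊂ Ω^{(j)}`, (203)
`|ũ′ʲ(y) − 1| < α₄ + 2C′₅α₄Lη + … + 2C′₅α₄Lʲη, y ∈ Ω^{(j)}`. (204) Let us notice that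
`α₄Lʲη + C₄β(Lʲη)² ≦ α₄Lʲη(1 + C₄(α₀ + α₃ + α₄)) ≦ 2α₄Lʲη ≦ 2α₄` for `α₀, α₃, α₄` sufficiently small, so the condition
`α′₄ = O(α₄)` mentioned above is satisfied indeed. The inequalities (203), (204) hold for `j = 0, 1`. We assume them for some `j`
and we will prove them for `j + 1`. We apply Proposition 9 with `V₀ = Ū₀ʲ, v′ = ũ′ʲ, v₁ = \overline{R₀u₁}ʲ`. We have `α₀` replaced by
`2α₀(Lʲη)²`, `α′₃` replaced by `α₃Lʲη`, `α₄` replaced by the right-hand side of (204), which can be bounded by `α₄(1 + 4C′₅) = C₅α₄`,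
and `α′₄` replaced by the right-hand side of (203), which can be bounded by `2α₄`. The conditions of the proposition are satisfied
if, e.g., `2α₀, α₃, C₅α₄, 2α₄ ≦ c′₆`, so we can apply it and we get
`|(ũ′^{j+1})⁻¹(c₋)R̄^{j+1}_{0,c}ũ′^{j+1}(c₊) − 1| < α₄L^{j+1}η + LC₄β(Lʲη)² + C′₄(2α₀C₅α₄ + α₃2α₄ + 4α₄²)(L^{j+1}η)²
< α₄L^{j+1}η + C₄β(L^{j+1}η)²[L⁻¹ + C′₄4C₅/C₄] ≦ α₄L^{j+1}η + C₄β(L^{j+1}η)²`, (205)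
`|ũ′^{j+1}(y) − 1| < α₄ + 2C′₅α₄Lη + … + 2C′₅α₄Lʲη + 2C′₅α₄L^{j+1}η`. (206) Thus we have proved the following"  p. 50:
"**Proposition 10.** There exist positive constants `C₄, C₅, c₆` such that for arbitrary configurations `U₀, u′, u₁` satisfying
(52), (176), (177), (166), (167) with `α₀, α₃, α₄ ≦ c₆` the bounds (203), (204) hold for `j ≦ k`.  This result implies in particular
that the configuration `u′` belongs to the class `Λ_k(C₅α₄)`. The assumptions (176), (177) can be reformulated in terms of the
functions `λ = (1/i) log u′`. …"

WHAT IS TYPED. The FLAT-BACKGROUND case `U₀ = 1` (`α₀ = 0`; every rotation `R₀ʲ, R̄ʲ_{0,c}` is the identity) of (201)–(206) and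
of Proposition 10, as KERNEL THEOREMS with EXPLICIT CONSTANTS, on top of the one-step Proposition 9 (`B7Prop9Flat.prop9_flat`) and
the recursion (179) (`B7Prop9Flat.util_succ`):
* `C5 d = 1 + 4·C′₅ = 1 + 256(d+1)`, `C4 d = 8·C′₄·C₅` (print's choices; `C′₄ = 10⁴(d+1)²`, `C′₅ = 64(d+1)` from `B7Prop9Flat`);
  `rhs203`, `rhs204` = the right-hand sides of (203), (204) (with `β = α₃α₄ + α₄²`); `rhs204_le` (`≤ C₅α₄`, p. 49 "which can be
  bounded by `α₄(1 + 4C′₅) = C₅α₄`", via `B7Eq167Flat.sum_pow_succ_le`), `rhs203_le` (`≤ 2α₄Lʲη`, p. 49 "Let us notice that …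
  `≦ 2α₄Lʲη`", under `C₄(α₃ + α₄) ≤ 1`), **`ineq205`** = (205), `rhs204_succ` = (206).
* **`prop10_flat`** — Proposition 10 at `U₀ = 1`: for `L ≥ 2`, `|u′ − 1| ≤ α₄` (176: `SiteBd u′ α₄`),
  `|u′(b₋)⁻¹u′(b₊) − 1| ≤ α₄η` (177: `BondBd u′ (α₄η)`), `u₁ ∈ Λ_k(1, α₃)` ((166)–(167): `B7Eq167Flat.InLambda L 1 u₁ k α₃ η`),
  `0 ≤ η`, `Lᵏη ≤ 1`, and the explicit smallness `0 ≤ α₃ ≤ 1/50`, `0 ≤ α₄`, `C₅α₄ ≤ 1`, `2·10³(d+1)Lα₄ ≤ 1`, `C₄(α₃ + α₄) ≤ 1`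
  (in place of "`α₀, α₃, α₄ ≤ c₆`"): for every `j ≤ k`, (203) `BondBd ũ′ʲ (α₄Lʲη + C₄β(Lʲη)²)` and
  (204) `SiteBd ũ′ʲ (α₄ + 2C′₅α₄ Σ_{i=1}^{j} Lⁱη)`, where `ũ′ʲ = B7Prop9Flat.util L u′ u₁ j`; the proof is print's induction, each
  step `prop9_flat` with `v′ = ũ′ʲ`, `v₁ = ū₁ʲ`, `α′₄ = ` (203)ⱼ `≤ 2α₄Lʲη`, `α₄ ↦ ` (204)ⱼ `≤ C₅α₄ ≤ 1`, `α′₃ = α₃Lʲη` ((167) at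
  `U₀ = 1` = `B7Prop8Flat.cond167_one_left_iff`), followed by (205) and (206).
* `prop10_flat'` — the closed forms `BondBd ũ′ʲ (2α₄Lʲη)`, `SiteBd ũ′ʲ (C₅α₄)` (p. 49, the two bounds just quoted; p. 50 "the
  configuration `u′` belongs to the class `Λ_k(C₅α₄)`").
* NOT TYPED: print's (201)/(202) as separate statements (they are the case `j = 1` of (203)/(204), with `C′₄ ≤ C₄`, `C′₅ ≤ 2C′₅`);
  the base of the kernel induction is `j = 0`, where (203)/(204) reduce to (177)/(176) (`rhs203_zero`, `rhs204_zero`).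

READINGS (recorded in `DIVERGENCE.md` D-b07g22.2; none is an objection to print).
(a) FLAT BACKGROUND ONLY (`U₀ = 1`, `α₀ = 0`), as for `B7Prop9Flat`: the term `2α₀C₅α₄` of (205) is absent; in the flat case
    `C₄ = 8C′₄` would do, print's `C₄ = 8C′₄C₅` is kept.  The curved statement is the schematic `B7.Prop10Printed` (by name; different
    interface, not instantiated); hand certification `GAPS.md` C-adv4-26 / C-B7-F.
(b) `L ≥ 2` is used in (205) (print's factor "`[L⁻¹ + C′₄4C₅/C₄]`" is `≤ 1` iff `L⁻¹ ≤ ½`, since `C′₄4C₅/C₄ = ½`) and in the bound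
    of (204) by `C₅α₄` (`Lη + ⋯ + Lʲη ≤ 2Lʲη`); print uses `L ≥ 2` tacitly (as in (168)–(169), cf. `B7Eq167Flat`).
(c) EXPLICIT SMALLNESS in place of `c₆` (print: "The conditions of the proposition are satisfied if, e.g., `2α₀, α₃, C₅α₄, 2α₄
    ≦ c′₆`" and "`≦ 2α₄Lʲη ≦ 2α₄` for `α₀, α₃, α₄` sufficiently small"): `α₃ ≤ 1/50` and `2·10³(d+1)Lα₄ ≤ 1` feed the hypotheses
    `α₃ ≤ 1/5`, `50Lα′₃ ≤ 1`, `10³(d+1)Lα′₄ ≤ 1` of `prop9_flat` (with `α′₃ = α₃Lʲη`, `α′₄ ≤ 2α₄Lʲη`, `L^{j+1}η ≤ 1` for `j < k`);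
    `C₅α₄ ≤ 1` gives `α₄`-of-step-`j` `≤ 1`; `C₄(α₃ + α₄) ≤ 1` makes print's "`1 + C₄(α₀ + α₃ + α₄) ≤ 2`" explicit.  `c₆` thus
    depends on `d` and `L`, as print allows ("positive constants" at fixed `d`, `L`).
(d) `u₁ ∈ Λ_k(U₀, α₃)` is (166) ∧ (167) (`InLambda`), with the block/coarse-coordinate conventions of `B7Eq167Flat`/`B7Prop9Flat`
    (all of `ℤ^d`, blocks `Lz + [0,L)^d`, `≤` for `<`).
(e) The final remark "This result implies in particular that the configuration `u′` belongs to the class `Λ_k(C₅α₄)`" is recorded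
    only as the closed form `prop10_flat'` ((166) for the averages of `u′` is (204) `≤ C₅α₄` with `u₁ = 1`; (167) is a tree-path
    condition while (203) bounds single coarse bonds, cf. `GAPS.md` N-B7-F2 on the constant) — not typed as an `InLambda` statement.

DECLARATIONS (4 definitions `C5 C4 rhs203 rhs204`; 13 theorems; imports `B7Prop9Flat` only).  Reused BY NAME: `B7Prop9Flat.SiteBd`,
`BondBd`, `BlockBd`, `util`, `util_zero`, `util_succ`, `vtil`, `prop9_flat`, `C4'`, `C5'`; `B7Prop8Flat.cond167_one_left_iff`,
`pow_eta_le`; `B7Eq167Flat.InLambda`, `Cond166`, `Cond167`, `sum_pow_succ_le`; `B7Eq84Concrete.uavg`.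

VERSION. v1.0.1 = v1 (p194080) with the PRINT paragraph and nine declaration docstrings re-quoted VERBATIM from the renders p029,
p030, p033, p034.  v1's "PRINT (verbatim)" paragraph for pp. 49–50 was in fact the lineage transcript's paraphrase: it presented
(201)/(202) as (177)/(176) restated (print's (201)/(202) are the first-application bounds quoted above), worded the induction and the
chain (205) differently from print, paged the p. 49 material as p. 50, and closed with a sentence ("This proposition will play an
important role in the future. Let us notice that … for `η ≥ 2L^{−k}`") that does NOT occur in print — withdrawn.  No declaration,
statement or proof changed; the kernel theorems `ineq205`, `rhs204_succ`, `prop10_flat`, `prop10_flat'` match print's (203)–(206) as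
now quoted (print's own (205) carries exactly the factor `L·C₄β(Lʲη)²` and the bracket `[L⁻¹ + 4C′₄C₅/C₄]` of `ineq205`).

[cite: Balaban1985Averaging, Proposition 10 p.50, (201)–(206) p.49, (176)–(179) p.45, (166)–(167) p.44]
-/

namespace Literature.MathematicalPhysics.QuantumFieldTheory.Balaban1983to89.B7Prop10Flat

noncomputable section

open NormedSpace Finset

open B7Prop1Explicit B7Eq84Concrete B7Eq167Flat B7Prop8Flat B7Prop9Flat

export B7Prop1Explicit (Site)

variable {d : ℕ}

variable {𝔸 : Type*} [NormedRing 𝔸] [NormedAlgebra ℂ 𝔸] [CompleteSpace 𝔸]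

omit [NormedAlgebra ℂ 𝔸] [CompleteSpace 𝔸] in
/-- Monotonicity of the site condition (176)/(180a) in the constant. [folklore] -/
theorem siteBd_mono {v : Site d → 𝔸ˣ} {α α' : ℝ} (h : SiteBd v α) (hle : α ≤ α') : SiteBd v α' :=
  fun x => (h x).trans hle

omit [NormedAlgebra ℂ 𝔸] [CompleteSpace 𝔸] in
/-- Monotonicity of the bond condition (177)/(180b) in the constant. [folklore] -/
theorem bondBd_mono {v : Site d → 𝔸ˣ} {α α' : ℝ} (h : BondBd v α) (hle : α ≤ α') : BondBd v α' :=
  fun x κ => (h x κ).trans hle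

/-- **The constant `C₅` of (204)/Proposition 10** (p. 49: "Let us denote `β = α₀α₄ + α₃α₄ + α₄²`, `C₅ = 1 + 4C′₅`, `C₄ = 8C′₄C₅`"):
`C₅ = 1 + 4C′₅ = 1 + 256(d+1)`. [cite: Balaban1985Averaging, (203)–(204) p.49, Proposition 10 p.50] -/
def C5 (d : ℕ) : ℝ := 1 + 4 * C5' d

/-- **The constant `C₄` of (203)/Proposition 10** (p. 49: "`C₄ = 8C′₄C₅`"): `C₄ = 8C′₄C₅`.
[cite: Balaban1985Averaging, (203)–(205) p.49, Proposition 10 p.50] -/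
def C4 (d : ℕ) : ℝ := 8 * C4' d * C5 d

/-- `1 ≤ C₅`. [folklore] -/
theorem one_le_C5 : (1 : ℝ) ≤ C5 d := by
  have : (0 : ℝ) ≤ C5' d := by unfold C5'; positivity
  unfold C5; linarith

/-- `0 ≤ C′₄`. [folklore] -/
theorem C4'_nonneg : (0 : ℝ) ≤ C4' d := by unfold C4'; positivity

/-- `0 ≤ C′₅`. [folklore] -/
theorem C5'_nonneg : (0 : ℝ) ≤ C5' d := by unfold C5'; positivity

/-- The right-hand side of **(203)** at `U₀ = 1`: `α₄Lʲη + C₄β(Lʲη)²`, `β = α₃α₄ + α₄²` (print's `β = α₀α₄ + α₃α₄ + α₄²` with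
`α₀ = 0`). [cite: Balaban1985Averaging, (203) p.49] -/
def rhs203 (d L j : ℕ) (α₃ α₄ η : ℝ) : ℝ :=
  α₄ * ((L : ℝ) ^ j * η) + C4 d * (α₃ * α₄ + α₄ ^ 2) * ((L : ℝ) ^ j * η) ^ 2

/-- The right-hand side of **(204)**: "`α₄ + 2C′₅α₄Lη + … + 2C′₅α₄Lʲη`". [cite: Balaban1985Averaging, (204) p.49] -/
def rhs204 (d L j : ℕ) (α₄ η : ℝ) : ℝ :=
  α₄ + 2 * C5' d * α₄ * ∑ i ∈ range j, (L : ℝ) ^ (i + 1) * η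

/-- (203) at `j = 0` reads `α₄η + C₄βη²` (⊇ (177); the base of the kernel induction — print starts from (201)/(202), the case
`j = 1`, and notes "The inequalities (203), (204) hold for `j = 0, 1`"). [cite: Balaban1985Averaging, (203) p.49, (177) p.45] -/
theorem rhs203_zero (d L : ℕ) (α₃ α₄ η : ℝ) :
    rhs203 d L 0 α₃ α₄ η = α₄ * η + C4 d * (α₃ * α₄ + α₄ ^ 2) * η ^ 2 := by
  simp [rhs203]

/-- (204) at `j = 0` reads `α₄` (= (176)). [cite: Balaban1985Averaging, (204) p.49, (176) p.45] -/
theorem rhs204_zero (d L : ℕ) (α₄ η : ℝ) : rhs204 d L 0 α₄ η = α₄ := by simp [rhs204]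

/-- **(206)**, the bookkeeping identity: "`< α₄ + 2C′₅α₄Lη + … + 2C′₅α₄Lʲη + 2C′₅α₄L^{j+1}η`" = (204) at `j + 1`.
[cite: Balaban1985Averaging, (206) p.49] -/
theorem rhs204_succ (d L j : ℕ) (α₄ η : ℝ) :
    rhs204 d L (j + 1) α₄ η = rhs204 d L j α₄ η + 2 * C5' d * α₄ * ((L : ℝ) ^ (j + 1) * η) := by
  simp only [rhs204, sum_range_succ]; ring

/-- p. 49: "`α₄` replaced by the right-hand side of (204), which can be bounded by `α₄(1 + 4C′₅) = C₅α₄`" — here via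
`Lη + ⋯ + Lʲη ≤ 2Lʲη ≤ 2` (`L ≥ 2`, `Lʲη ≤ 1`; `B7Eq167Flat.sum_pow_succ_le`). [cite: Balaban1985Averaging, (204) p.49] -/
theorem rhs204_le {L : ℕ} (hL : 2 ≤ L) {j : ℕ} {α₄ η : ℝ} (hα₄ : 0 ≤ α₄) (hη : 0 ≤ η) (ht : (L : ℝ) ^ j * η ≤ 1) :
    rhs204 d L j α₄ η ≤ C5 d * α₄ := by
  have hLr : (2 : ℝ) ≤ L := by exact_mod_cast hL
  have hs := sum_pow_succ_le hLr 0 j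
  simp only [zero_add] at hs
  have hsum : ∑ i ∈ range j, (L : ℝ) ^ (i + 1) * η ≤ 2 * ((L : ℝ) ^ j * η) := by
    rw [← sum_mul]; nlinarith
  have hC := C5'_nonneg (d := d)
  unfold rhs204 C5
  have : 2 * C5' d * α₄ * ∑ i ∈ range j, (L : ℝ) ^ (i + 1) * η ≤ 2 * C5' d * α₄ * (2 * 1) := by
    have h0 : 0 ≤ 2 * C5' d * α₄ := by positivity
    exact mul_le_mul_of_nonneg_left (hsum.trans (by linarith)) h0
  nlinarith

/-- p. 49: "Let us notice that `α₄Lʲη + C₄β(Lʲη)² ≦ α₄Lʲη(1 + C₄(α₀ + α₃ + α₄)) ≦ 2α₄Lʲη ≦ 2α₄` for `α₀, α₃, α₄` sufficiently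
small" — here under the explicit `C₄(α₃ + α₄) ≤ 1` (`α₀ = 0`) and `Lʲη ≤ 1`. [cite: Balaban1985Averaging, (203) p.49] -/
theorem rhs203_le {L j : ℕ} {α₃ α₄ η : ℝ} (hα₄ : 0 ≤ α₄) (hη : 0 ≤ η) (ht : (L : ℝ) ^ j * η ≤ 1)
    (hC : C4 d * (α₃ + α₄) ≤ 1) :
    rhs203 d L j α₃ α₄ η ≤ 2 * α₄ * ((L : ℝ) ^ j * η) := by
  unfold rhs203
  set t := (L : ℝ) ^ j * η with ht_def
  have ht0 : 0 ≤ t := by positivity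
  have h1 : C4 d * (α₃ * α₄ + α₄ ^ 2) * t ^ 2 ≤ α₄ * t := by
    have : C4 d * (α₃ * α₄ + α₄ ^ 2) * t ^ 2 = (C4 d * (α₃ + α₄)) * (α₄ * t) * t := by ring
    rw [this]
    have h2 : (C4 d * (α₃ + α₄)) * (α₄ * t) ≤ 1 * (α₄ * t) :=
      mul_le_mul_of_nonneg_right hC (by positivity)
    calc C4 d * (α₃ + α₄) * (α₄ * t) * t ≤ 1 * (α₄ * t) * 1 := by
          apply mul_le_mul h2 ht ht0 (by positivity)
      _ = α₄ * t := by ring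
  linarith

/-- **(205)** (p. 49): the one-step bond constant of Proposition 9 applied with `α′₄ = α₄Lʲη + C₄β(Lʲη)² ≤ 2α₄Lʲη`,
`α′₃ = α₃Lʲη` is again of the form (203) at the next scale: "`< α₄L^{j+1}η + LC₄β(Lʲη)² + C′₄(2α₀C₅α₄ + α₃2α₄ + 4α₄²)(L^{j+1}η)²
< α₄L^{j+1}η + C₄β(L^{j+1}η)²[L⁻¹ + C′₄4C₅/C₄] ≦ α₄L^{j+1}η + C₄β(L^{j+1}η)²`" (here with `L ≥ 2`, which is what makes the bracket
`≤ 1`; the flat case has `α₀ = 0`). [cite: Balaban1985Averaging, (205) p.49] -/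
theorem ineq205 {L : ℕ} (hL : 2 ≤ L) {j : ℕ} {α₃ α₄ η : ℝ} (hα₃ : 0 ≤ α₃) (hα₄ : 0 ≤ α₄) (hη : 0 ≤ η)
    (ht : (L : ℝ) ^ j * η ≤ 1) (hC : C4 d * (α₃ + α₄) ≤ 1) :
    L * rhs203 d L j α₃ α₄ η
        + C4' d * (L : ℝ) ^ 2 * (α₃ * ((L : ℝ) ^ j * η) * rhs203 d L j α₃ α₄ η + rhs203 d L j α₃ α₄ η ^ 2)
      ≤ rhs203 d L (j + 1) α₃ α₄ η := by
  have hA := rhs203_le (d := d) hα₄ hη ht hC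
  have hLr : (2 : ℝ) ≤ L := by exact_mod_cast hL
  set A := rhs203 d L j α₃ α₄ η with hA_def
  set t := (L : ℝ) ^ j * η with ht_def
  have ht0 : 0 ≤ t := by positivity
  have hC4' := C4'_nonneg (d := d)
  have hC5' := C5'_nonneg (d := d)
  have hA0 : 0 ≤ A := by
    rw [hA_def]; unfold rhs203; rw [← ht_def]; unfold C4 C5; positivity
  have hC5 := one_le_C5 (d := d)
  have hsucc : rhs203 d L (j + 1) α₃ α₄ η = α₄ * (L * t) + C4 d * (α₃ * α₄ + α₄ ^ 2) * (L * t) ^ 2 := by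
    unfold rhs203; rw [ht_def]; ring
  rw [hsucc]
  have hAj : A = α₄ * t + C4 d * (α₃ * α₄ + α₄ ^ 2) * t ^ 2 := by rw [hA_def]; unfold rhs203; rw [ht_def]
  -- the three error terms
  have hβ0 : 0 ≤ α₃ * α₄ + α₄ ^ 2 := by positivity
  have e1 : (L : ℝ) * (C4 d * (α₃ * α₄ + α₄ ^ 2) * t ^ 2) ≤ C4 d * (α₃ * α₄ + α₄ ^ 2) * (L * t) ^ 2 / 2 := by
    have : C4 d * (α₃ * α₄ + α₄ ^ 2) * (L * t) ^ 2 / 2 - (L : ℝ) * (C4 d * (α₃ * α₄ + α₄ ^ 2) * t ^ 2)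
        = C4 d * (α₃ * α₄ + α₄ ^ 2) * t ^ 2 * (L * (L - 2) / 2) := by ring
    have h0 : 0 ≤ C4 d * (α₃ * α₄ + α₄ ^ 2) * t ^ 2 * (L * (L - 2) / 2) := by
      unfold C4; apply mul_nonneg (by positivity); nlinarith
    linarith
  have e2 : α₃ * t * A ≤ 2 * (α₃ * α₄) * t ^ 2 := by
    have := mul_le_mul_of_nonneg_left hA (show 0 ≤ α₃ * t by positivity); nlinarith
  have e3 : A ^ 2 ≤ 4 * α₄ ^ 2 * t ^ 2 := by nlinarith
  have e23 : C4' d * (L : ℝ) ^ 2 * (α₃ * t * A + A ^ 2) ≤ 4 * C4' d * (α₃ * α₄ + α₄ ^ 2) * (L * t) ^ 2 := by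
    have h1 := mul_le_mul_of_nonneg_left (add_le_add e2 e3) (show 0 ≤ C4' d * (L : ℝ) ^ 2 by positivity)
    have h2 : C4' d * (L : ℝ) ^ 2 * (2 * (α₃ * α₄) * t ^ 2 + 4 * α₄ ^ 2 * t ^ 2)
        ≤ 4 * C4' d * (α₃ * α₄ + α₄ ^ 2) * (L * t) ^ 2 := by
      have : 4 * C4' d * (α₃ * α₄ + α₄ ^ 2) * (L * t) ^ 2
          - C4' d * (L : ℝ) ^ 2 * (2 * (α₃ * α₄) * t ^ 2 + 4 * α₄ ^ 2 * t ^ 2)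
          = 2 * C4' d * (L : ℝ) ^ 2 * t ^ 2 * (α₃ * α₄) := by ring
      have : 0 ≤ 2 * C4' d * (L : ℝ) ^ 2 * t ^ 2 * (α₃ * α₄) := by positivity
      linarith
    exact h1.trans h2
  have e4 : 4 * C4' d * (α₃ * α₄ + α₄ ^ 2) * (L * t) ^ 2 ≤ C4 d * (α₃ * α₄ + α₄ ^ 2) * (L * t) ^ 2 / 2 := by
    unfold C4
    have : 4 * C4' d ≤ 8 * C4' d * C5 d / 2 := by nlinarith
    have h0 : 0 ≤ (α₃ * α₄ + α₄ ^ 2) * (L * t) ^ 2 := by positivity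
    nlinarith
  calc (L : ℝ) * A + C4' d * (L : ℝ) ^ 2 * (α₃ * t * A + A ^ 2)
      = α₄ * (L * t) + (L : ℝ) * (C4 d * (α₃ * α₄ + α₄ ^ 2) * t ^ 2)
          + C4' d * (L : ℝ) ^ 2 * (α₃ * t * A + A ^ 2) := by rw [hAj]; ring
    _ ≤ α₄ * (L * t) + C4 d * (α₃ * α₄ + α₄ ^ 2) * (L * t) ^ 2 / 2
          + C4 d * (α₃ * α₄ + α₄ ^ 2) * (L * t) ^ 2 / 2 := by linarith
    _ = α₄ * (L * t) + C4 d * (α₃ * α₄ + α₄ ^ 2) * (L * t) ^ 2 := by ring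

/-- **Proposition 10 at the flat background** (p. 50: "There exist positive constants `C₄, C₅, c₆` such that for arbitrary
configurations `U₀, u′, u₁` satisfying (52), (176), (177), (166), (167) with `α₀, α₃, α₄ ≤ c₆` the bounds (203), (204) hold for
`j ≤ k`"), here with `U₀ = 1` and the explicit `C₄ = 8C′₄C₅`, `C₅ = 1 + 4C′₅` (`C′₄ = 10⁴(d+1)²`, `C′₅ = 64(d+1)`), `L ≥ 2`, and
the explicit smallness `α₃ ≤ 1/50`, `C₅α₄ ≤ 1`, `2·10³(d+1)Lα₄ ≤ 1`, `C₄(α₃ + α₄) ≤ 1` in place of `c₆`: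
for `|u′ − 1| ≤ α₄` (176), `|u′(b₋)⁻¹u′(b₊) − 1| ≤ α₄η` (177) and `u₁ ∈ Λ_k(1, α₃)` ((166), (167)), the functions (178)
`ũ′ʲ = \overline{(u′u₁)}ʲ·(ū₁ʲ)⁻¹` satisfy, for all `j ≤ k`,
**(203)** `|ũ′ʲ(c₋)⁻¹ũ′ʲ(c₊) − 1| ≤ α₄Lʲη + C₄β(Lʲη)²`, `β = α₃α₄ + α₄²`, and
**(204)** `|ũ′ʲ − 1| ≤ α₄ + 2C′₅α₄(Lη + ⋯ + Lʲη)`.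
The proof is print's induction (205)–(206) on `j`, each step being Proposition 9 (`prop9_flat`) with `v′ = ũ′ʲ`, `v₁ = ū₁ʲ`,
`α′₄ = ` (203)ⱼ, `α₄ = ` (204)ⱼ `≤ C₅α₄`, `α′₃ = α₃Lʲη` ((167) via `cond167_one_left_iff`), and the recursion (179) `util_succ`.
[cite: Balaban1985Averaging, Proposition 10 p.50, (201)–(206) p.49, (176)–(179) p.45] -/
theorem prop10_flat {L : ℕ} (hL : 2 ≤ L) {u' u₁ : Site d → 𝔸ˣ} {k : ℕ} {α₃ α₄ η : ℝ}
    (h176 : SiteBd u' α₄) (h177 : BondBd u' (α₄ * η))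
    (hu₁ : InLambda L (1 : Site d → Fin d → 𝔸ˣ) u₁ k α₃ η)
    (hη : 0 ≤ η) (hk : (L : ℝ) ^ k * η ≤ 1) (hα₃ : 0 ≤ α₃) (hα₃' : α₃ ≤ 1 / 50) (hα₄ : 0 ≤ α₄)
    (hs₁ : C5 d * α₄ ≤ 1) (hs₂ : 2000 * ((d : ℝ) + 1) * L * α₄ ≤ 1) (hs₃ : C4 d * (α₃ + α₄) ≤ 1) :
    ∀ j ≤ k, BondBd (util L u' u₁ j) (rhs203 d L j α₃ α₄ η) ∧ SiteBd (util L u' u₁ j) (rhs204 d L j α₄ η) := by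
  have hL1 : 1 ≤ L := le_trans (by norm_num) hL
  have hLr : (2 : ℝ) ≤ L := by exact_mod_cast hL
  have h167 := (cond167_one_left_iff L u₁ k α₃ η).1 hu₁.2
  intro j hj
  induction j with
  | zero =>
    refine ⟨?_, ?_⟩
    · rw [util_zero, rhs203_zero]
      refine bondBd_mono h177 ?_
      have : 0 ≤ C4 d * (α₃ * α₄ + α₄ ^ 2) * η ^ 2 := by
        unfold C4 C5; have := C4'_nonneg (d := d); have := C5'_nonneg (d := d); positivity
      linarith
    · rw [util_zero, rhs204_zero]; exact h176
  | succ j ih =>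
    have hjk : j < k := hj
    obtain ⟨hB, hS⟩ := ih hjk.le
    -- the scale parameter `t = Lʲη ≤ 1`, and `L t ≤ 1`
    have ht := (pow_eta_le hL1 hη hk hjk.le).1
    have hLt : (L : ℝ) * ((L : ℝ) ^ j * η) ≤ 1 := by
      have := (pow_eta_le hL1 hη hk (Nat.succ_le_of_lt hjk)).1; rw [pow_succ] at this; linarith
    have ht0 : 0 ≤ (L : ℝ) ^ j * η := by positivity
    have hA := rhs203_le (d := d) hα₄ hη ht hs₃
    have hA0 : 0 ≤ rhs203 d L j α₃ α₄ η := by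
      unfold rhs203 C4 C5; have := C4'_nonneg (d := d); have := C5'_nonneg (d := d); positivity
    have hT := rhs204_le (d := d) hL hα₄ hη ht
    -- hypotheses of Proposition 9 at step `j`
    have h3c : SiteBd (uavg L 1 u₁ j) α₃ := fun z => hu₁.1 j hjk.le z
    have h3d : BlockBd L (uavg L 1 u₁ j) (L * (α₃ * (L : ℝ) ^ j * η)) := by
      intro z r
      have := h167 j hjk z r
      calc _ ≤ α₃ * (L : ℝ) ^ (j + 1) * η := this
        _ = L * (α₃ * (L : ℝ) ^ j * η) := by ring
    have hq : 50 * (L * (α₃ * (L : ℝ) ^ j * η)) ≤ 1 := by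
      have : L * (α₃ * (L : ℝ) ^ j * η) = α₃ * (L * ((L : ℝ) ^ j * η)) := by ring
      rw [this]; nlinarith
    have hs : 1000 * ((d : ℝ) + 1) * L * rhs203 d L j α₃ α₄ η ≤ 1 := by
      have h0 : 0 ≤ 1000 * ((d : ℝ) + 1) * L := by positivity
      have h1 := mul_le_mul_of_nonneg_left hA h0
      have h2 : 1000 * ((d : ℝ) + 1) * L * (2 * α₄ * ((L : ℝ) ^ j * η)) ≤ 2000 * ((d : ℝ) + 1) * L * α₄ * 1 := by
        have : 0 ≤ 2000 * ((d : ℝ) + 1) * L * α₄ := by positivity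
        nlinarith
      linarith
    have h9 := prop9_flat hL1 hS hB h3c h3d (hT.trans hs₁) hA0 (by linarith) hq hs
    rw [← util_succ] at h9
    refine ⟨bondBd_mono h9.1 ?_, siteBd_mono h9.2 ?_⟩
    · -- (205)
      have := ineq205 (d := d) hL hα₃ hα₄ hη ht hs₃
      have e : C4' d * (L : ℝ) ^ 2 * (α₃ * (L : ℝ) ^ j * η * rhs203 d L j α₃ α₄ η + rhs203 d L j α₃ α₄ η ^ 2)
          = C4' d * (L : ℝ) ^ 2 * (α₃ * ((L : ℝ) ^ j * η) * rhs203 d L j α₃ α₄ η + rhs203 d L j α₃ α₄ η ^ 2) := by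
        ring
      rw [e]; exact this
    · -- (206)
      rw [rhs204_succ]
      have h0 : 0 ≤ C5' d * (L : ℝ) := by have := C5'_nonneg (d := d); positivity
      have := mul_le_mul_of_nonneg_left hA h0
      have e : 2 * C5' d * α₄ * ((L : ℝ) ^ (j + 1) * η) = C5' d * L * (2 * α₄ * ((L : ℝ) ^ j * η)) := by ring
      rw [e]; linarith

/-- **Proposition 10, closed form** (p. 49: the right-hand side of (204) "can be bounded by `α₄(1 + 4C′₅) = C₅α₄`", that of
(203) "by `2α₄`" — here by `2α₄Lʲη`; p. 50: "This result implies in particular that the configuration `u′` belongs to the class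
`Λ_k(C₅α₄)`"): under the hypotheses of `prop10_flat`, for all `j ≤ k`, `|ũ′ʲ(c₋)⁻¹ũ′ʲ(c₊) − 1| ≤ 2α₄Lʲη` and `|ũ′ʲ − 1| ≤ C₅α₄`.
[cite: Balaban1985Averaging, Proposition 10 p.50, (203)–(204) p.49] -/
theorem prop10_flat' {L : ℕ} (hL : 2 ≤ L) {u' u₁ : Site d → 𝔸ˣ} {k : ℕ} {α₃ α₄ η : ℝ}
    (h176 : SiteBd u' α₄) (h177 : BondBd u' (α₄ * η))
    (hu₁ : InLambda L (1 : Site d → Fin d → 𝔸ˣ) u₁ k α₃ η)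
    (hη : 0 ≤ η) (hk : (L : ℝ) ^ k * η ≤ 1) (hα₃ : 0 ≤ α₃) (hα₃' : α₃ ≤ 1 / 50) (hα₄ : 0 ≤ α₄)
    (hs₁ : C5 d * α₄ ≤ 1) (hs₂ : 2000 * ((d : ℝ) + 1) * L * α₄ ≤ 1) (hs₃ : C4 d * (α₃ + α₄) ≤ 1) :
    ∀ j ≤ k, BondBd (util L u' u₁ j) (2 * α₄ * ((L : ℝ) ^ j * η)) ∧ SiteBd (util L u' u₁ j) (C5 d * α₄) := by
  intro j hj
  have hL1 : 1 ≤ L := le_trans (by norm_num) hL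
  have ht := (pow_eta_le hL1 hη hk hj).1
  obtain ⟨hB, hS⟩ := prop10_flat hL h176 h177 hu₁ hη hk hα₃ hα₃' hα₄ hs₁ hs₂ hs₃ j hj
  exact ⟨bondBd_mono hB (rhs203_le hα₄ hη ht hs₃), siteBd_mono hS (rhs204_le hL hα₄ hη ht)⟩

end

end Literature.MathematicalPhysics.QuantumFieldTheory.Balaban1983to89.B7Prop10Flat
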